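import Mathlib
import Summits.KontsevichZagierPeriods.Zeta5Search.ClusterValuation
import Summits.KontsevichZagierPeriods.Zeta5Search.PalindromicClassBounds
import Summits.KontsevichZagierPeriods.Zeta5Search.DenomLaw.ThresholdModelCensusSums

/-!
# ζ(5) search — DENOM-LAW: the threshold model, PART IV (the level configuration of a dominant class), part A: the self-mirror class, the open window, numerator levels

Cell `pub-zeta5`, track DENOM-LAW (K1 typing order item (1), «ThresholdModel port»): denom-engine-d2 g14's kernel-checked scratch module
`denom-law/engine-d2/g14/lean/LevelCensusConfig.lean` PART IV (THRESHOLD-X6) filed VERBATIM in four parts (≤ 400 lines each; docstrings added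
where the scratch file had none) by denom-prover-d1 g5.  Part A of 4 (= 13th file of the port).
HONEST FRAMING: systematic search; MODEL/structure side — the level configuration of a dominant class identified with the tree's `classConfig`/`IsPalindromic` and the rung-M/K coefficient rows in closed form; nothing about ζ(5); no γ; no irrationality claim; records in print UNMOVED.
The mathematical header of PART IV is the second module docstring of part A (`ThresholdModelConfig.lean`).
-/

namespace Summit.KontsevichZagierPeriods.Zeta5Search.DenomLaw.ThresholdModel.Rho

/-! # PART IV — THE LEVEL CONFIGURATION OF A DOMINANT CLASS: `ClusterValuation.classConfig`, `IsPalindromic` (the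
PALINDROME BONUS of Theorem B / `classBound`), `HasPoleOfOrder`, `GoodClasses`, and the tree's PROVED coefficient bounds
`wLB / uLB / wLBpal / uLBpal` (rungs M and K) in the threshold model (denom-engine-d2 g14, scratch typing; NOT a tree filing;
one extra import w.r.t. Part III: `Summits.KontsevichZagierPeriods.Zeta5Search.PalindromicClassBounds`, for (X6-6) only)

HONEST FRAMING: as Parts I–III — MODEL/structure side, elementary integer bookkeeping about which integers of a residue
class lie in the Pochhammer blocks / the numerator of a Brown–Zudilin cell; no linear form, no p-adic digit, no kernel
VALUE of any form; nothing about ζ(5); no γ; no irrationality claim; records in print UNMOVED.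

THE TREE'S OBJECTS (`Zeta5Search/ClusterValuation.lean` §1–§2): for a residue `x` the LEVEL CONFIGURATION
`classConfig b p x = {(2q, netExp b q) : q ∈ classSet b p x, netExp b q ≠ 0} ∪ {(b₀, 1) : b₀ odd ∧ CentreIn b p x}`
(doubled positions), the test `IsPalindromic S ⟺ ∃ M, ∀ (P, e) ∈ S, (M − P, e) ∈ S` (with `M` a sum of two first
coordinates), `HasPoleOfOrder b p x s ⟺ ∃ q ∈ classSet, netExp b q ≤ −s`, the CLASS BOUND
`classBound b p x s = s + E_x + [IsPalindromic (classConfig b p x) ∧ s + E_x odd]` on classes with `≥ 2` poles (g6/g7's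
`T_x(s)` WITH THE PALINDROME BONUS of Theorem B — the accounting rung "K" of census g13 / `PalindromicClassBounds.lean`),
and Theorem C's hypothesis `GoodClasses b p s ⟺ ∀ x < p, 2 ≤ classPoleCount → 1 ≤ s + E_x`.

## What is proved here (kernel-checked), for a DOMINANT class `u` (Part I) of a DEEP tree cell `b` (`BCell` at
`q = (m−1)p`, octave `m ≥ 1`, `p` odd `≥ 3`) and any residue `x` of that class:
* `DeepCell.not_isDominant_self`, `lt_p_of_dominant`, `dpos_eq_zero_imp`: the self-mirror class `u = p` is NEVER dominant
  (`L(p) ≥ 6`), so a dominant class sits in the open window `−p < u < p`, where `d(ℓ,u) = 0` forces `u = 0`.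
* `DeepCell.numCov_iff_of_dominant`: the numerator levels of the class are EXACTLY `−n₋ ≤ ℓ ≤ 3m − 2 + n₊`;
  `domNetExp` / `netE_of_dominant` / `domNetExp_lowEdge|highEdge|interior|eq_one|ne_zero`: along the class the net
  exponent of `R_b` is, level by level, `+1` (zero frame and the extra levels `−1`, `3m−1`), `L − 6`, `R − 6` (frame edges,
  `≤ −2`), `−6 + [d = 0]` (interior) — NO numerator level of a dominant class is neutral.
* **`mem_classConfig_iff`** — THE CONFIGURATION BY LEVELS: `(P, e) ∈ classConfig b p x` iff `P = b₀ + d(ℓ,u)`,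
  `e = domNetExp(ℓ,u)` for a level `−n₋ ≤ ℓ ≤ 3m−2+n₊`, or `(P, e) = (b₀, 1)` and `u = 0`, `m` odd (the odd centre).
* **`isPalindromic_iff_of_dominant`** — THE PALINDROME CRITERION: `IsPalindromic (classConfig b p x) ⟺ L(u) = R(u) ∧
  n₊(u) = n₋(u)` (the reflection is `ℓ ↦ 3m−2−ℓ`, `P ↦ 2b₀ − 2u − P`; it fixes the merged/odd centre iff `u = 0`);
  `isPalindromic_of_dominant_zero`: the centre class `u = 0`, when dominant, is always palindromic.
* **`classBound_of_dominant`**, **`classBound_of_dominant_odd`**: `T_x(s) = s + E_x + [L = R ∧ n₊ = n₋ ∧ s + E_x odd]`, and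
  for odd `s` (`W`: `s = 3`, `U`: `s = 5`): `T_x(s) = s + δ(u) + [u = 0] − (4m+8) + [u ≠ 0 ∧ L(u) = R(u) ∧ n₊(u) = n₋(u)]`
  — on the D region the palindrome bonus fires exactly on the mirror-symmetric root types OFF the centre class.
* `hasPoleOfOrder_iff_of_dominant` (orders met: `6 − L`, `6 − R`, and the interior `6`, lowered to `5` at the merged centre
  — visible only at `m = 2`, `u = 0`), `hasPoleOfOrder_two`; `DeepCell.exists_dominant`; **`not_goodClasses_of_deep`**:
  `H(s)` fails on every deep cell for `s ≤ 4m + 3` (Theorem C never applies on the D region; (T1-iii)/(T1-v) do).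
* (X6-6) **`wLB_of_deep`, `uLB_of_deep`, `wLBpal_of_deep_all / _not`, `uLBpal_of_deep_all / _not`** (via `minRow_eq`,
  `minRowPal_eq_of_all / _of_not`, `classExp_vs_dominant`): the tree's PROVED bounds `v_p(W) ≥ wLB`, `v_p(U) ≥ uLB`
  (`CoefficientClassBounds`, rung M) and `v_p(W) ≥ wLBpal`, `v_p(U) ≥ uLBpal` (`PalindromicClassBounds(Proof)`, rung K) read on a
  deep cell: `wLB = 3 + score(u₀) − (4m+8)`, `uLB = 5 + score(u₀) − (4m+8)` for any dominant `u₀`, and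
  `wLBpal = wLB + β`, `uLBpal = uLB + β` with `β = [every dominant class u has u ≠ 0 ∧ L(u) = R(u) ∧ n₊(u) = n₋(u)]` —
  rung K lifts the cell's proved `W`/`U` bounds by exactly one unit iff ALL dominant classes fire the bonus.
Kernel examples (`decide` on the tree's definitions): the (1,11) cells `(30; 12,9,9,7,7,7,7)` (classes `u = ±1`: `L = R = 1`,
palindromic, bonus at `s = 3`; `wLB = −7`, `wLBpal = −6`, `uLB = −5`, `uLBpal = −4`), `(31; 13,10,10,7,7,7,7)` (`u = 0` with
the odd centre `(31, 1)`: palindromic, no bonus at odd `s`), and `(28; 10,9,9,8,7,7,7)` (`u = 1`: `L = 3 ≠ R = 1`, not palindromic).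
Numerical companion: `denom-law/code/d2g14/config14.py` recomputes `classConfig`, `IsPalindromic`, `HasPoleOfOrder`,
`classBound`, `GoodClasses`, `wLB/uLB/wLBpal/uLBpal` from the tree's definitions and checks the closed forms on every dominant
class / every cell of g10's eight exhaustive deep blocks + the (1,11) design block + F2 (258,706 cells, 720,912 (cell, class) pairs).
-/

section Config

open Summit.KontsevichZagierPeriods.Zeta5Search.ClusterValuation
  (blockCount netExp classSet classExp CentreIn classPoleCount HasPoleOfOrder classConfig IsPalindromic classBound
    GoodClasses)

/-! ### (X6-0) the self-mirror class `u = p` is never dominant; the open window; the numerator levels -/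

namespace DeepCell
variable {p R0 : ℤ} {r : Fin 7 → ℤ} {u : ℤ}

/-- on a deep cell six blocks lie below `2p` (`ρ₆ ≤ ρ₇`, `ρ₆ + ρ₇ ≤ 4p − 2`): `L(p) = #{ρ_j < 2p} ≥ 6`. -/
theorem six_le_L_self (h : DeepCell p R0 r) : 6 ≤ L p r p := by
  have h56 : r 5 ≤ r 6 := h.r_le (by decide)
  have h5 : r 5 < p + p := by linarith [h.pair_hi]
  have := countLt_ge h.mono 5 h5
  simp at this
  unfold L
  linarith

/-- **the self-mirror class `u = p` is never dominant on a deep cell** (`δ(p) ≥ L(p) ≥ 6 > 4`). -/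
theorem not_isDominant_self (h : DeepCell p R0 r) : ¬ IsDominant p R0 r p := by
  intro hd
  have h4 := h.dominant_delta_le_four hd
  have h6 := h.six_le_L_self
  have h1 := countLt_nonneg r (p - p)
  have h2 := indic_nonneg (2 * p - R0 ≤ p)
  have h3 := indic_nonneg (p ≤ R0 - 2 * p)
  unfold delta R np nm at h4
  linarith

/-- so a dominant class lies in the OPEN window `−p < u < p` … -/
theorem lt_p_of_dominant (h : DeepCell p R0 r) (hd : IsDominant p R0 r u) : u < p := by
  rcases lt_or_eq_of_le hd.1.2.1 with h1 | h1
  · exact h1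
  · rw [h1] at hd; exact absurd hd h.not_isDominant_self

/-- … where `d(ℓ,u) = 0` forces `u = 0` and `2ℓ = 3m − 2`: the merged even centre is met by the centre class only. -/
theorem dpos_eq_zero_imp (h : DeepCell p R0 r) (hd : IsDominant p R0 r u) {m ℓ : ℤ} (h0 : dpos p m ℓ u = 0) :
    u = 0 ∧ 2 * ℓ = 3 * m - 2 := by
  have hu1 := hd.1.1
  have hu2 := h.lt_p_of_dominant hd
  have hp := h.three_le_p
  unfold dpos at h0
  rcases lt_trichotomy (2 * ℓ - 3 * m + 2) 0 with hk | hk | hk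
  · have : p * (2 * ℓ - 3 * m + 2) ≤ p * (-1) := mul_le_mul_of_nonneg_left (by omega) (by linarith)
    exfalso; linarith
  · refine ⟨?_, by omega⟩
    rw [hk, mul_zero] at h0; linarith
  · have : p * 1 ≤ p * (2 * ℓ - 3 * m + 2) := mul_le_mul_of_nonneg_left (by omega) (by linarith)
    exfalso; linarith

/-- the four exponents of a dominant class are small: `L, R ≤ 4`, `L + R + n₊ + n₋ = δ ≤ 4`. -/
theorem LRnn_le_four (h : DeepCell p R0 r) (hd : IsDominant p R0 r u) :
    L p r u ≤ 4 ∧ R p r u ≤ 4 ∧ L p r u + R p r u + np p R0 u + nm p R0 u ≤ 4 := by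
  have h4 := h.dominant_delta_le_four hd
  have a := countLt_nonneg r (u + p)
  have c := countLt_nonneg r (p - u)
  have d := indic_nonneg (2 * p - R0 ≤ u)
  have e := indic_nonneg (u ≤ R0 - 2 * p)
  unfold delta at h4
  unfold L R np nm at h4 ⊢
  exact ⟨by linarith, by linarith, h4⟩

/-- **THE NUMERATOR LEVELS OF A DOMINANT CLASS**: `NumCov(ℓ,u) ⟺ −n₋(u) ≤ ℓ ≤ 3m − 2 + n₊(u)` (the whole range
`[0, 3m−2]` since `|u| ≤ R₀`, plus the level `−1` iff `u ≤ R₀ − 2p` and the level `3m−1` iff `u ≥ 2p − R₀`). -/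
theorem numCov_iff_of_dominant (h : DeepCell p R0 r) (hd : IsDominant p R0 r u) {m : ℤ} (hm : 1 ≤ m) (ℓ : ℤ) :
    NumCov p m R0 ℓ u ↔ -nm p R0 u ≤ ℓ ∧ ℓ ≤ 3 * m - 2 + np p R0 u := by
  have hb := h.levelBox
  have hp : 1 ≤ p := hb.one_le_p
  have hR0 := hb.R0_nonneg
  have hu1 : -p ≤ u := by linarith [hd.1.1]
  have hu2 : u ≤ p := hd.1.2.1
  obtain ⟨hA1, hA2, -, -⟩ := h.dominant_admissible hd
  have hRp : R0 ≤ R0 + p := by linarith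
  unfold np nm indic
  rcases (show ℓ ≤ -2 ∨ ℓ = -1 ∨ (0 ≤ ℓ ∧ ℓ ≤ m - 2) ∨ ℓ = m - 1 ∨ (m ≤ ℓ ∧ ℓ ≤ 2 * m - 2) ∨ ℓ = 2 * m - 1 ∨
      (2 * m ≤ ℓ ∧ ℓ ≤ 3 * m - 2) ∨ ℓ = 3 * m - 1 ∨ 3 * m ≤ ℓ by omega)
    with hℓ | hℓ | ⟨h0, h1⟩ | hℓ | ⟨h0, h1⟩ | hℓ | ⟨h0, h1⟩ | hℓ | hℓ
  · have hN := (cov_below hp hb.R0_lt hRp hm hu1 hℓ).2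
    constructor
    · exact fun hc => absurd hc hN
    · rintro ⟨hlo, -⟩; exfalso; split_ifs at hlo <;> omega
  · subst hℓ; rw [numCov_bottom_iff hp hm hu1]; split_ifs <;> omega
  · rw [numCov_zeroLo_iff hp hR0 hu1 hu2 h0 h1]; split_ifs <;> omega
  · subst hℓ; rw [numCov_lowEdge_iff hp hR0 hm hu1 hu2]; split_ifs <;> omega
  · have hN := (cov_interior hp hR0 hR0 hu1 hu2 h0 h1).2
    exact ⟨fun _ => by split_ifs <;> omega, fun _ => hN⟩
  · subst hℓ; rw [numCov_highEdge_iff hp hR0 hm hu1 hu2]; split_ifs <;> omega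
  · rw [numCov_zeroHi_iff hp hR0 hu1 hu2 h0 h1]; split_ifs <;> omega
  · subst hℓ; rw [numCov_top_iff hp hm hu2]; split_ifs <;> omega
  · have hN := (cov_above hp hb.R0_lt hRp hm hu2 hℓ).2
    constructor
    · exact fun hc => absurd hc hN
    · rintro ⟨-, hhi⟩; exfalso; split_ifs at hhi <;> omega

/-- the level range of a dominant class is an honest interval: `−n₋ ≤ m − 1 < 2m − 1 ≤ 3m − 2 + n₊`. -/
theorem nm_np_range (u : ℤ) {m : ℤ} (hm : 1 ≤ m) :
    -nm p R0 u ≤ m - 1 ∧ 2 * m - 1 ≤ 3 * m - 2 + np p R0 u := by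
  have d := indic_nonneg (2 * p - R0 ≤ u)
  have e := indic_nonneg (u ≤ R0 - 2 * p)
  unfold np nm
  constructor <;> linarith

end DeepCell

end Config

end Summit.KontsevichZagierPeriods.Zeta5Search.DenomLaw.ThresholdModel.Rho
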